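import Summits.CriticalPhenomena.CardyFormulaZ2.Theorems.CardyComplexConeParafermionToSLESixFamiliesDiamondIdentifyMesh
import HarnessLib

/-!
# Line `potential-darboux-picard-diamond`, stub S4′ (`stub_identifyPotentialPh`): side cells all along a boundary segment

Helper file of the stub `stub_identifyPotentialPh` of crux `ParafermionToSLESixFamilies` (stmt-CriticalPhenomena-11389).
Step (ii′) of the identification ("DIR in the limit") evaluates (DIR)/(LOW) of `ExactPotentialTracePh` at SIDE CELLS
(`sideCells (Λ δ) δ p q η`: cells with centre within `3δ` of the boundary segment `[p, q]` and `η`-away from `p, q`)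
converging to prescribed points of the open segment. This file supplies them: for an admissible family of a marked
diamond, an oriented boundary segment `[p, q]`, and a point `z` of the segment at distance `> η` from both endpoints,
for all small `δ` there is a side cell with centre within `3δ` of `z` (`eventually_exists_sideCell`, registered helper of
the crux item). Proof: the segment lies in one side line of the tilted rectangle
(`exists_sideLine_of_segment_subset_frontier`); in the frame `e′ ∈ {e, −e, −ie, ie}` of that side the construction is
uniform (`exists_sideCell_of_frame`): aim at the point `2δ` inside the diamond below `z`, take the face whose centre is
nearest (`nearestSite`, error `≤ δ`), and check with the `1`-Lipschitz tilted coordinates that the `3 × 3` block of its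
deepest corner (depth `δ/√2` below the centre, `exists_deep_corner`) stays inside, so that the face is a cell
(`isCell_of_block`, every lattice point of the diamond being in `Ω_δ` by `eventually_mem_meshDomain_of_isMarkedDiamond`).
-/

noncomputable section

namespace Summit.CriticalPhenomena.CardyFormulaZ2.Cruxes.ParafermionToSLESixFamilies.PotentialDarbouxPicardDiamond

open scoped Topology ComplexConjugate
open Filter Set Metric Complex
open Literature.Probability Literature.Probability.LatticeModels Literature.Probability.Percolation
open Literature.Probability.LatticeModels.DiscreteDobrushin
open Literature.Probability.RandomPlanarGeometry
open Summit.CriticalPhenomena.CardyFormulaZ2.Cruxes.ParafermionToSLESixFamilies.IicTraceFluxPairing (IsFamily)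

/-! ## Small lemmas -/

/-- A complex number with zero real part has norm `|im|`. -/
theorem norm_eq_abs_im_of_re_eq_zero {u : ℂ} (h : u.re = 0) : ‖u‖ = |u.im| := by
  have hu : u = (u.im : ℂ) * I := Complex.ext (by simp [h]) (by simp)
  rw [hu, norm_mul, norm_I, mul_one, norm_real, Real.norm_eq_abs, ← hu]

/-- A complex number with zero imaginary part has norm `|re|`. -/
theorem norm_eq_abs_re_of_im_eq_zero {u : ℂ} (h : u.im = 0) : ‖u‖ = |u.re| := by
  have hu : u = (u.re : ℂ) := Complex.ext (by simp) (by simp [h])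
  rw [hu, norm_real, Real.norm_eq_abs, ← hu]

/-- For unimodular `e`, distances are read in the tilted frame: `dist w w′ = ‖(w − c)e − (w′ − c)e‖`. -/
theorem dist_eq_norm_tilt_sub (c e : ℂ) (he : ‖e‖ = 1) (w w' : ℂ) :
    dist w w' = ‖(w - c) * e - (w' - c) * e‖ := by
  rw [dist_eq_norm, show (w - c) * e - (w' - c) * e = (w - w') * e by ring, norm_mul, he, mul_one]

/-- The tilted coordinates along the parametrised segment `p + t (q − p)`. -/
theorem tilt_param (c e p q : ℂ) (t : ℝ) :
    ((p + t • (q - p) - c) * e).re = ((p - c) * e).re + t * (((q - c) * e).re - ((p - c) * e).re) ∧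
      ((p + t • (q - p) - c) * e).im = ((p - c) * e).im + t * (((q - c) * e).im - ((p - c) * e).im) := by
  have h : (p + t • (q - p) - c) * e = (p - c) * e + (t : ℂ) * ((q - c) * e - (p - c) * e) := by
    rw [real_smul]; ring
  rw [h, add_re, add_im, re_ofReal_mul, im_ofReal_mul, sub_re, sub_im]
  exact ⟨rfl, rfl⟩

/-- Distances from a point of the parametrised segment to its endpoints. -/
theorem dist_param (p q : ℂ) {t : ℝ} (ht0 : 0 ≤ t) (ht1 : t ≤ 1) :
    dist (p + t • (q - p)) p = t * ‖q - p‖ ∧ dist (p + t • (q - p)) q = (1 - t) * ‖q - p‖ := by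
  rw [dist_eq_norm, dist_eq_norm, real_smul]
  constructor
  · rw [show p + (t : ℂ) * (q - p) - p = (t : ℂ) * (q - p) by ring, norm_mul, norm_real, Real.norm_eq_abs,
      abs_of_nonneg ht0]
  · rw [show p + (t : ℂ) * (q - p) - q = ((1 - t : ℝ) : ℂ) * (-(q - p)) by push_cast; ring, norm_mul, norm_neg,
      norm_real, Real.norm_eq_abs, abs_of_nonneg (by linarith)]

/-- A parameter bound: if `|a|, |b| ≤ β` and `m ≤ t|b − a|`, `m ≤ (1 − t)|b − a|`, then
`|a + t(b − a)| + m ≤ β`. -/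
theorem abs_param_add_le {a b t β m : ℝ} (ha : |a| ≤ β) (hb : |b| ≤ β) (h1 : m ≤ t * |b - a|) (h2 : m ≤ (1 - t) * |b - a|) : |a + t * (b - a)| + m ≤ β := by
  have ha' := abs_le.1 ha
  have hb' := abs_le.1 hb
  rcases le_or_gt a b with hab | hab
  · rw [abs_of_nonneg (sub_nonneg.2 hab)] at h1 h2
    have e1 : a + t * (b - a) = b - (1 - t) * (b - a) := by ring
    have hup : a + t * (b - a) ≤ β - m := by rw [e1]; linarith
    have hlo : -(β - m) ≤ a + t * (b - a) := by linarith
    linarith [abs_le.2 ⟨hlo, hup⟩]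
  · rw [abs_of_neg (sub_neg.2 hab)] at h1 h2
    have e1 : a + t * (b - a) = b + (1 - t) * (a - b) := by ring
    have hup : a + t * (b - a) ≤ β - m := by nlinarith
    have hlo : -(β - m) ≤ a + t * (b - a) := by rw [e1]; nlinarith
    linarith [abs_le.2 ⟨hlo, hup⟩]

/-- A parameter for a nearby value: if `m ≤ t|b − a|`, `m ≤ (1 − t)|b − a|` and `|y − (a + t(b − a))| ≤ d < m`, then
`y = a + s(b − a)` with `0 ≤ s ≤ 1`. -/
theorem exists_param_of_close {a b t m d y : ℝ} (h1 : m ≤ t * |b - a|) (h2 : m ≤ (1 - t) * |b - a|)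
    (hd : |y - (a + t * (b - a))| ≤ d) (hdm : d < m) : ∃ s : ℝ, 0 ≤ s ∧ s ≤ 1 ∧ y = a + s * (b - a) := by
  have hd' := abs_le.1 hd
  have hba : b - a ≠ 0 := by
    intro h0
    rw [h0, abs_zero, mul_zero] at h1
    linarith [abs_nonneg (y - (a + t * (b - a)))]
  refine ⟨(y - a) / (b - a), ?_, ?_, by field_simp; ring⟩
  · rcases lt_or_gt_of_ne hba with hneg | hpos
    · rw [abs_of_neg hneg] at h1 h2
      exact div_nonneg_of_nonpos (by nlinarith) hneg.le
    · rw [abs_of_pos hpos] at h1 h2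
      exact div_nonneg (by nlinarith) hpos.le
  · rcases lt_or_gt_of_ne hba with hneg | hpos
    · rw [abs_of_neg hneg] at h1 h2
      rw [div_le_one_of_neg hneg]; nlinarith
    · rw [abs_of_pos hpos] at h1 h2
      rw [div_le_one hpos]; nlinarith

/-- The centre of the face indexed by the nearest site is within `δ` of the target. -/
theorem dist_ctr_nearestSite_le {δ : ℝ} (hδ : 0 < δ) (w : ℂ) :
    dist (ctr δ (nearestSite δ (w - (δ : ℂ) * (1 + I) / 2))) w ≤ δ := by
  have h := dist_meshPoint_nearestSite_le hδ (w - (δ : ℂ) * (1 + I) / 2)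
  rw [dist_eq_norm] at h ⊢
  rw [ctr, show meshPoint δ (nearestSite δ (w - (δ : ℂ) * (1 + I) / 2)) + (δ : ℂ) * (1 + I) / 2 - w =
    meshPoint δ (nearestSite δ (w - (δ : ℂ) * (1 + I) / 2)) - (w - (δ : ℂ) * (1 + I) / 2) by ring]
  exact h

/-! ## Side cells in a frame -/

/-- **Side cells in a frame.** Let `e` be unimodular, `Ω = {|re((z−c)e)| < α, |im((z−c)e)| < β}` the carrier of the
data `E` read at its mesh `δ`, every lattice point of `Ω` in `Ω_δ`, and suppose every face has a corner at tilted depth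
`δ/√2` below its centre (`hdeep`, the lattice input of the frame). Let `p, q` lie on the side line `re = α` of the closed
rectangle and `z ∈ [p, q]` with `dist z p, dist z q ≥ η + 3δ`, `δ ≤ η`, `4δ ≤ α`. Then some side cell of `[p, q]` (trim
`η`) has its centre within `3δ` of `z`. -/
theorem exists_sideCell_of_frame (c e : ℂ) (he : ‖e‖ = 1) {α β δ η : ℝ} (hδ : 0 < δ) (hδα : 4 * δ ≤ α)
    (hδη : δ ≤ η) {E : DiscreteDobrushin} (hΩ : E.Ω = {z : ℂ | |((z - c) * e).re| < α ∧ |((z - c) * e).im| < β})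
    (hEδ : E.δ = δ) (hgood : ∀ x : Site 2, meshPoint δ x ∈ E.Ω → x ∈ meshDomain E.Ω δ)
    (hdeep : ∀ x : Site 2, ∃ v : Site 2, IsCorner v x ∧ ((meshPoint δ v - ctr δ x) * e).re = -(Real.sqrt 2 / 2 * δ))
    {p q z : ℂ} (hp : ((p - c) * e).re = α) (hq : ((q - c) * e).re = α) (hpβ : |((p - c) * e).im| ≤ β)
    (hqβ : |((q - c) * e).im| ≤ β) (hz : z ∈ segment ℝ p q) (hzp : η + 3 * δ ≤ dist z p)
    (hzq : η + 3 * δ ≤ dist z q) :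
    ∃ f ∈ sideCells E δ p q η, dist z (ctr δ f) ≤ 3 * δ := by
  have he0 : e ≠ 0 := fun h0 => by rw [h0, norm_zero] at he; exact zero_ne_one he
  have hce : conj e * e = 1 := by
    rw [mul_comm, mul_conj, normSq_eq_norm_sq, he]; simp
  -- the constant `r = √2 δ`: `δ ≤ r ≤ 3δ/2`
  set r : ℝ := Real.sqrt 2 * δ with hr
  have hs2 : Real.sqrt 2 < 3 / 2 := by rw [Real.sqrt_lt' (by norm_num)]; norm_num
  have hs2' : 1 < Real.sqrt 2 := by rw [Real.lt_sqrt (by norm_num)]; norm_num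
  have hr1 : δ ≤ r := by rw [hr]; nlinarith
  have hr2 : r ≤ 3 / 2 * δ := by rw [hr]; nlinarith
  have hhalf : Real.sqrt 2 / 2 * δ = r / 2 := by rw [hr]; ring
  -- Lipschitz bounds of the tilted coordinates
  have hLipX : ∀ w w' : ℂ, |((w - c) * e).re - ((w' - c) * e).re| ≤ dist w w' := fun w w' => by
    rw [dist_eq_norm]; exact abs_re_tilt_sub_le c e he w w'
  have hLipY : ∀ w w' : ℂ, |((w - c) * e).im - ((w' - c) * e).im| ≤ dist w w' := fun w w' => by
    rw [dist_eq_norm]; exact abs_im_tilt_sub_le c e he w w'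
  -- the parameter of `z`, its tilted coordinates and its distances to the endpoints
  rw [segment_eq_image' ℝ p q] at hz
  obtain ⟨t, ⟨ht0, ht1⟩, rfl⟩ := hz
  obtain ⟨hXz, hYz⟩ := tilt_param c e p q t
  rw [hp, hq, sub_self, mul_zero, add_zero] at hXz
  have hqp : ‖q - p‖ = |((q - c) * e).im - ((p - c) * e).im| := by
    rw [← dist_eq_norm, dist_eq_norm_tilt_sub c e he, norm_eq_abs_im_of_re_eq_zero (by rw [sub_re, hq, hp, sub_self]),
      sub_im]
  obtain ⟨hdp, hdq⟩ := dist_param p q ht0 ht1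
  rw [hdp, hqp] at hzp
  rw [hdq, hqp] at hzq
  set a : ℝ := ((p - c) * e).im with ha
  set b : ℝ := ((q - c) * e).im with hb
  set z := p + t • (q - p) with hzdef
  have hYz_bd : |a + t * (b - a)| + (η + 3 * δ) ≤ β := abs_param_add_le hpβ hqβ hzp hzq
  -- the target `w`, `2δ` inside below `z`, and the face `x` with nearest centre
  set w : ℂ := z - ((2 * δ : ℝ) : ℂ) * conj e with hw
  have hwz : (w - c) * e = (z - c) * e - ((2 * δ : ℝ) : ℂ) := by
    rw [hw, show (z - ((2 * δ : ℝ) : ℂ) * conj e - c) * e = (z - c) * e - ((2 * δ : ℝ) : ℂ) * (conj e * e) by ring,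
      hce, mul_one]
  have hXw : ((w - c) * e).re = α - 2 * δ := by rw [hwz, sub_re, ofReal_re, hXz]
  have hYw : ((w - c) * e).im = a + t * (b - a) := by rw [hwz, sub_im, ofReal_im, sub_zero, hYz]
  have hdzw : dist z w = 2 * δ := by
    rw [hw, dist_eq_norm, sub_sub_cancel, norm_mul, norm_real, norm_conj, he, mul_one, Real.norm_eq_abs,
      abs_of_pos (by positivity)]
  set x : Site 2 := nearestSite δ (w - (δ : ℂ) * (1 + I) / 2) with hx
  have hcw : dist (ctr δ x) w ≤ δ := dist_ctr_nearestSite_le hδ w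
  have hXc : |((ctr δ x - c) * e).re - (α - 2 * δ)| ≤ δ := by rw [← hXw]; exact (hLipX _ _).trans hcw
  have hYc : |((ctr δ x - c) * e).im - (a + t * (b - a))| ≤ δ := by rw [← hYw]; exact (hLipY _ _).trans hcw
  have hzc : dist z (ctr δ x) ≤ 3 * δ := by
    have := dist_triangle z w (ctr δ x)
    rw [hdzw, dist_comm w] at this
    linarith
  -- the deepest corner `v` of `x` and its block
  obtain ⟨v, hv, hvdeep⟩ := hdeep x
  have hvsub : (meshPoint δ v - ctr δ x) * e = (meshPoint δ v - c) * e - (ctr δ x - c) * e := by ring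
  have hXv : ((meshPoint δ v - c) * e).re = ((ctr δ x - c) * e).re - r / 2 := by
    have h1 := congrArg Complex.re hvsub
    rw [sub_re, hvdeep, hhalf] at h1
    linarith
  have hYv : |((meshPoint δ v - c) * e).im - ((ctr δ x - c) * e).im| ≤ r / 2 := by
    have h1 := congrArg Complex.im hvsub
    rw [sub_im] at h1
    rw [← h1, ← hhalf]
    exact (abs_im_le_norm _).trans (by rw [norm_mul, he, mul_one]; exact norm_corner_sub_ctr_le hδ.le hv)
  have hXc' := abs_le.1 hXc
  have hYc' := abs_le.1 hYc
  have hYv' := abs_le.1 hYv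
  have hblock : ∀ y : Site 2, (∀ i, |y i - v i| ≤ 1) → meshPoint δ y ∈ E.Ω := by
    intro y hy
    have hn := norm_meshPoint_sub_le_of_block hδ.le hy
    rw [← dist_eq_norm] at hn
    have hXy := abs_le.1 ((hLipX (meshPoint δ y) (meshPoint δ v)).trans hn)
    have hYy := abs_le.1 ((hLipY (meshPoint δ y) (meshPoint δ v)).trans hn)
    have hYzb := abs_le.1 (show |a + t * (b - a)| ≤ β - η - 3 * δ by linarith)
    rw [hΩ]
    constructor
    · rw [abs_lt]; constructor <;> linarith
    · rw [abs_lt]; constructor <;> linarith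
  have hcell : IsCell E x :=
    isCell_of_block (Ω := E.Ω) (by rw [hΩ]; exact convex_tiltedBox c e α β) hgood rfl hEδ hv hblock
  -- the foot of the centre on the side line lies on the segment
  obtain ⟨s, hs0, hs1, hs⟩ : ∃ s : ℝ, 0 ≤ s ∧ s ≤ 1 ∧ ((ctr δ x - c) * e).im = a + s * (b - a) :=
    exists_param_of_close hzp hzq hYc (by linarith)
  set zs : ℂ := p + s • (q - p) with hzs
  have hzs_mem : zs ∈ segment ℝ p q := by
    rw [segment_eq_image' ℝ p q]; exact ⟨s, ⟨hs0, hs1⟩, rfl⟩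
  obtain ⟨hXzs, hYzs⟩ := tilt_param c e p q s
  rw [hp, hq, sub_self, mul_zero, add_zero] at hXzs
  have hdcs : dist (ctr δ x) zs = |((ctr δ x - c) * e).re - α| := by
    rw [dist_eq_norm_tilt_sub c e he, norm_eq_abs_re_of_im_eq_zero, sub_re, hXzs]
    rw [sub_im, hYzs, hs, sub_self]
  -- conclusion
  refine ⟨x, ⟨hcell, ?_, ?_, ?_⟩, hzc⟩
  · calc infDist (ctr δ x) (segment ℝ p q) ≤ dist (ctr δ x) zs := infDist_le_dist_of_mem hzs_mem
      _ ≤ 3 * δ := by rw [hdcs, abs_le]; constructor <;> linarith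
  · have := dist_triangle z (ctr δ x) p
    rw [hdp, hqp] at this
    linarith
  · have := dist_triangle z (ctr δ x) q
    rw [hdq, hqp] at this
    linarith

/-! ## The four frames of the diamond -/

/-- The offset of the corner `x + g` from the centre of the face `x`, in the frame `e = exp(−iπ/4)`. -/
theorem corner_sub_ctr_mul_exp (δ : ℝ) (x g : Site 2) :
    (meshPoint δ (x + g) - ctr δ x) * exp (-(Real.pi / 4 : ℝ) * I) =
      ((Real.sqrt 2 / 2 * δ : ℝ) : ℂ) * ((((g 0 : ℝ) + g 1 - 1 : ℝ) : ℂ) + (((g 1 : ℝ) - g 0 : ℝ) : ℂ) * I) := by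
  rw [ctr, meshPoint_add, exp_neg_pi_div_four_mul_I]
  apply Complex.ext
  · simp [meshPoint_re, meshPoint_im, mul_re]; ring
  · simp [meshPoint_re, meshPoint_im, mul_im]; ring

/-- **The deepest corner in each of the four frames** `e·ε`, `ε ∈ {1, −1, −i, i}` (the outward normals of the four sides
of the diamond): some corner of every face lies at tilted depth exactly `δ/√2` below the centre. -/
theorem exists_deep_corner (δ : ℝ) (ε : ℂ) (hε : ε = 1 ∨ ε = -1 ∨ ε = -I ∨ ε = I) (x : Site 2) :
    ∃ v : Site 2, IsCorner v x ∧
      ((meshPoint δ v - ctr δ x) * (exp (-(Real.pi / 4 : ℝ) * I) * ε)).re = -(Real.sqrt 2 / 2 * δ) := by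
  rcases hε with rfl | rfl | rfl | rfl
  · refine ⟨x + 0, by rw [add_zero]; exact isCorner_self x, ?_⟩
    rw [← mul_assoc, corner_sub_ctr_mul_exp]
    simp
  · refine ⟨x + (Pi.single 0 1 + Pi.single 1 1), fun j => by fin_cases j <;> simp, ?_⟩
    rw [← mul_assoc, corner_sub_ctr_mul_exp]
    simp
  · refine ⟨x + Pi.single 0 1, fun i => by fin_cases i <;> simp, ?_⟩
    rw [← mul_assoc, corner_sub_ctr_mul_exp]
    simp
  · refine ⟨x + Pi.single 1 1, fun i => by fin_cases i <;> simp, ?_⟩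
    rw [← mul_assoc, corner_sub_ctr_mul_exp]
    simp

/-- **Side cells all along a boundary segment of a marked diamond.** Along an admissible family of a marked diamond,
for an oriented boundary segment `[p, q]`, a trim `η > 0` and a point `z ∈ [p, q]` at distance `> η` from `p` and from
`q`: for all small meshes `δ` there is a side cell `f ∈ sideCells (Λ δ) δ p q η` whose centre is within `3δ` of `z`. -/
theorem eventually_exists_sideCell : ∀ (D : DobrushinDomain), IsMarkedDiamond D → ∀ (Λ : ℝ → DiscreteDobrushin), IsFamily D Λ → ∀ (p q : ℂ), IsBdrySegment D p q → ∀ η : ℝ, 0 < η → ∀ z ∈ segment ℝ p q, η < dist z p → η < dist z q → ∀ᶠ δ in 𝓝[>] (0:ℝ), ∃ f ∈ sideCells (Λ δ) δ p q η, dist z (ctr δ f) ≤ 3 * δ := by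
  intro D hD Λ hΛ p q hpq η hη z hz hzp hzq
  have hgoodev := eventually_mem_meshDomain_of_isMarkedDiamond D hD
  obtain ⟨c, α, β, hα, hβ, hcar⟩ := hD
  set e : ℂ := exp (-(Real.pi / 4 : ℝ) * I) with hedef
  have he1 : ‖e‖ = 1 := norm_exp_neg_pi_div_four_mul_I
  have he0 : e ≠ 0 := fun h0 => by rw [h0, norm_zero] at he1; exact zero_ne_one he1
  -- the segment lies in one side line, inside the closed rectangle
  have hsub : segment ℝ p q ⊆ frontier {z : ℂ | |((z - c) * e).re| < α ∧ |((z - c) * e).im| < β} := by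
    rw [← hcar]; exact hpq.2.1
  have hclosed : ∀ w ∈ segment ℝ p q, |((w - c) * e).re| ≤ α ∧ |((w - c) * e).im| ≤ β := fun w hw =>
    ((mem_frontier_tiltedBox_iff c e he0 hα hβ w).1 (hsub hw)).1
  have hpcl := hclosed p (left_mem_segment ℝ p q)
  have hqcl := hclosed q (right_mem_segment ℝ p q)
  have hside := exists_sideLine_of_segment_subset_frontier c e α β p q he0 hα hβ hpq.1 hsub
  -- smallness of the mesh
  have hsmall : ∀ᶠ δ in 𝓝[>] (0:ℝ), 0 < δ ∧ 4 * δ ≤ min α β ∧ δ ≤ η ∧ η + 3 * δ ≤ dist z p ∧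
      η + 3 * δ ≤ dist z q := by
    have hm : 0 < min (min (min α β / 4) η) (min ((dist z p - η) / 3) ((dist z q - η) / 3)) :=
      lt_min (lt_min (by positivity) hη) (lt_min (by linarith) (by linarith))
    filter_upwards [Ioo_mem_nhdsGT hm] with δ hδ
    obtain ⟨hδ0, hδ1⟩ := hδ
    have h1 := lt_of_lt_of_le (lt_of_lt_of_le hδ1 (min_le_left _ _)) (min_le_left _ _)
    have h1' := lt_of_lt_of_le (lt_of_lt_of_le hδ1 (min_le_left _ _)) (min_le_right _ _)
    have h2 := lt_of_lt_of_le (lt_of_lt_of_le hδ1 (min_le_right _ _)) (min_le_left _ _)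
    have h3 := lt_of_lt_of_le (lt_of_lt_of_le hδ1 (min_le_right _ _)) (min_le_right _ _)
    exact ⟨hδ0, by linarith, h1'.le, by linarith, by linarith⟩
  filter_upwards [hgoodev, hsmall] with δ hgood hδs
  obtain ⟨hδ0, hδm, hδη, hzp', hzq'⟩ := hδs
  have hΩ : (Λ δ).Ω = D.carrier := hΛ.1 δ
  have hEδ : (Λ δ).δ = δ := hΛ.2.1 δ
  have hgood' : ∀ x : Site 2, meshPoint δ x ∈ (Λ δ).Ω → x ∈ meshDomain (Λ δ).Ω δ := by rw [hΩ]; exact hgood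
  have hδα : 4 * δ ≤ α := hδm.trans (min_le_left α β)
  have hδβ : 4 * δ ≤ β := hδm.trans (min_le_right α β)
  -- the four frames
  rcases hside with h1 | h1 | h1 | h1
  · -- side `re = α`: frame `e`
    refine exists_sideCell_of_frame (α := α) (β := β) c e he1 hδ0 hδα hδη (by rw [hΩ, hcar]) hEδ hgood' ?_
      (h1 p (left_mem_segment ℝ p q)) (h1 q (right_mem_segment ℝ p q)) hpcl.2 hqcl.2 hz hzp' hzq'
    intro x
    obtain ⟨v, hv, hre⟩ := exists_deep_corner δ 1 (Or.inl rfl) x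
    exact ⟨v, hv, by rw [mul_one] at hre; exact hre⟩
  · -- side `re = -α`: frame `-e`
    refine exists_sideCell_of_frame (α := α) (β := β) c (-e) (by rw [norm_neg, he1]) hδ0 hδα hδη ?_ hEδ hgood'
      ?_ ?_ ?_ ?_ ?_ hz hzp' hzq'
    · rw [hΩ, hcar]; ext w; simp only [mem_setOf_eq, mul_neg, neg_re, neg_im, abs_neg]
    · intro x
      obtain ⟨v, hv, hre⟩ := exists_deep_corner δ (-1) (Or.inr (Or.inl rfl)) x
      exact ⟨v, hv, by rw [mul_neg_one] at hre; exact hre⟩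
    · rw [mul_neg, neg_re, h1 p (left_mem_segment ℝ p q), neg_neg]
    · rw [mul_neg, neg_re, h1 q (right_mem_segment ℝ p q), neg_neg]
    · rw [mul_neg, neg_im, abs_neg]; exact hpcl.2
    · rw [mul_neg, neg_im, abs_neg]; exact hqcl.2
  · -- side `im = β`: frame `-ie`
    refine exists_sideCell_of_frame (α := β) (β := α) c (e * -I) (by rw [norm_mul, norm_neg, norm_I, he1, mul_one])
      hδ0 hδβ hδη ?_ hEδ hgood' ?_ ?_ ?_ ?_ ?_ hz hzp' hzq'
    · rw [hΩ, hcar]; ext w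
      simp only [mem_setOf_eq, ← mul_assoc, mul_neg, mul_I_re, mul_I_im, neg_re, neg_im, neg_neg, abs_neg]
      exact and_comm
    · intro x
      obtain ⟨v, hv, hre⟩ := exists_deep_corner δ (-I) (Or.inr (Or.inr (Or.inl rfl))) x
      exact ⟨v, hv, hre⟩
    · rw [← mul_assoc, mul_neg, neg_re, mul_I_re, neg_neg]; exact h1 p (left_mem_segment ℝ p q)
    · rw [← mul_assoc, mul_neg, neg_re, mul_I_re, neg_neg]; exact h1 q (right_mem_segment ℝ p q)
    · rw [← mul_assoc, mul_neg, neg_im, mul_I_im, abs_neg]; exact hpcl.1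
    · rw [← mul_assoc, mul_neg, neg_im, mul_I_im, abs_neg]; exact hqcl.1
  · -- side `im = -β`: frame `ie`
    refine exists_sideCell_of_frame (α := β) (β := α) c (e * I) (by rw [norm_mul, norm_I, he1, mul_one]) hδ0 hδβ hδη
      ?_ hEδ hgood' ?_ ?_ ?_ ?_ ?_ hz hzp' hzq'
    · rw [hΩ, hcar]; ext w
      simp only [mem_setOf_eq, ← mul_assoc, mul_I_re, mul_I_im, abs_neg]
      exact and_comm
    · intro x
      obtain ⟨v, hv, hre⟩ := exists_deep_corner δ I (Or.inr (Or.inr (Or.inr rfl))) x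
      exact ⟨v, hv, hre⟩
    · rw [← mul_assoc, mul_I_re, h1 p (left_mem_segment ℝ p q), neg_neg]
    · rw [← mul_assoc, mul_I_re, h1 q (right_mem_segment ℝ p q), neg_neg]
    · rw [← mul_assoc, mul_I_im]; exact hpcl.1
    · rw [← mul_assoc, mul_I_im]; exact hqcl.1

end Summit.CriticalPhenomena.CardyFormulaZ2.Cruxes.ParafermionToSLESixFamilies.PotentialDarbouxPicardDiamond

end
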